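import Literature.Computability.AlgebraicComplexity.BI17GenericTernaryQuarticStabilizer
import Literature.Computability.AlgebraicComplexity.GenericFormsNonsingular
import HarnessLib

/-!
# Poonen 2005, Thm. 3 for plane quartics over `ℂ` — proved

Theorem-only file (cell `val-lit`, rows X3-Poonen05 / BI2017-A; no definitions, no named facts).
B. Poonen, *Varieties without extra automorphisms III: hypersurfaces*, Finite Fields Appl. 11
(2005), Thm. 3: "Suppose that `n ≥ 1`, `d ≥ 3`, and `(n,d) ≠ (1,3)`. Then `U_{n,d}` is nonempty.
In other words, the generic hypersurface `X` of degree `d` in `ℙ^{n+1}` has `Lin X = {1}`" — typed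
in the tree as the open cite-fact `poonen2005_thm_3` (all algebraically closed `K`, all `(n, d)`).
Here its instance `K = ℂ`, `(n, d) = (1, 4)` (PLANE QUARTICS; classically Chang 1978, Katz–Sarnak
10.6.18) is a THEOREM: `poonen2005_thm_3_planeQuartic_complex`, the conjunction of the cell's two
genericity theorems — generic smoothness (`isZariskiGeneric_isNonsingularForm`, elimination
theory) and generic trivial stabilizer (`isZariskiGeneric_hasTrivialStabilizer_ternaryQuartic`,
dimension count over the Jordan types of `GL₃`) — via the dictionary
`hasTrivialLinAut_iff_hasTrivialStabilizer` (`Lin X_f = {1} ↔ stab(f) = μ_d · I`).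

This is the literature witness behind the cell's erratum A21 on Bürgisser–Ikenmeyer 2017 Thm. 2.3
(`a'(4,3) = 1`, not `2`), now kernel-checked at the strength Poonen states it (over `ℂ`). The
general fact `poonen2005_thm_3` (all `K`, all `(n, d)`) stays open. Honest framing: classical
bookkeeping; nothing here bears on VP versus VNP.

## References

* [Poonen2005] B. Poonen, Finite Fields Appl. 11 (2005) 230–268, Thm. 3.
* [BurgisserIkenmeyer2017] P. Bürgisser, C. Ikenmeyer, J. Algebra 477 (2017), §2.1 Thm. 2.3.
-/

noncomputable section

open MvPolynomial

namespace Literature.Computability.AlgebraicComplexity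

open _root_.Literature.AlgebraicGeometry.Motives.SmoothHypersurface

/-- **Poonen 2005 Thm. 3 at `(n, d) = (1, 4)` over `ℂ`, PROVED**: a Zariski-generic plane quartic
`X = {f = 0} ⊂ ℙ²_ℂ` is smooth and has `Lin X = {1}` (every linear transformation preserving `f`
up to a scalar is scalar). Instance `K = ℂ, n = 1, d = 4` of the typed fact `poonen2005_thm_3`.
[cite: Poonen2005, Thm. 3] -/
theorem poonen2005_thm_3_planeQuartic_complex :
    IsZariskiGeneric 4 fun f : MvPolynomial (Fin (1 + 2)) ℂ =>
      IsNonsingularForm ℂ f ∧ HasTrivialLinAut f :=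
  ((isZariskiGeneric_isNonsingularForm (n := 1) (D := 4) (by norm_num)).and
    isZariskiGeneric_hasTrivialStabilizer_ternaryQuartic).mono fun f hf h =>
    ⟨h.1, (hasTrivialLinAut_iff_hasTrivialStabilizer hf (by norm_num)
      (ne_zero_of_isNonsingularForm h.1)).mpr h.2⟩

/-- The same in BI 2017's language with the stabilizer data spelled out: a generic ternary quartic
is nonsingular, has `stab = μ₄ · I`, stabilizer period `a = 4` and reduced period `a' = 1`
(BI 2017 Thm. 2.3 at `(4, 3)` as corrected by erratum A21, with Poonen's smoothness clause).
[cite: BurgisserIkenmeyer2017, Thm. 2.3] -/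
theorem isZariskiGeneric_ternaryQuartic_nonsingular_trivialStabilizer :
    IsZariskiGeneric 4 fun f : MvPolynomial (Fin 3) ℂ =>
      IsNonsingularForm ℂ f ∧ HasTrivialStabilizer 4 f ∧ stabilizerPeriod f = 4 ∧
        reducedStabilizerPeriod 4 f = 1 :=
  (isZariskiGeneric_isNonsingularForm (n := 1) (D := 4) (by norm_num)).and
    isZariskiGeneric_ternaryQuartic_trivialStabilizer_period

end Literature.Computability.AlgebraicComplexity
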